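import Mathlib
import Summits.Ventures.PercRepro2.HCov
import Summits.Ventures.PercRepro2.FourFunctions
import Summits.Ventures.PercRepro2.BHKEvents
import Summits.Ventures.PercRepro2.ISplit
import Summits.Ventures.PercRepro2.ZOloc
import Summits.Ventures.PercRepro2.HCovSwap
import Summits.Ventures.PercRepro2.CovFourTerm
import Summits.Ventures.PercRepro2.FirstOrderTerms
import Summits.Ventures.PercRepro2.PendantCovMass
import Summits.Ventures.PercRepro2.PendantB2Dict

/-!
# The degenerate corner `D = 0` of the degree-one-root contraction (blind cell PercRepro2, p5 g24;
`proofs/P5-OEDGE.md` §30)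

At an instance with `D = P(PD) = 0` every `PD`-mass, `D_o`, `Dmix` and `Cc` vanish and the
single-instance functional `Tcl` of `PendantB2Dict.lean` is the bad corner `Q·D₀·Ψ(σ̄_b, γ₀)` alone.
Two MEET inequalities (the four functions theorem `prob_mul_prob_le_of_sup_inf`, `C = univ`) locate
this corner: a configuration of `T′ = {a₁ ↮ a₂, a₃ ∈ C₁}` met with a configuration of `{a₁ ↮ a₃}` lies
in `PD`, and a configuration of `{a₁ ↔ a₂, a₁ ↮ a₃}` met with a configuration of `Q = {a₁ ↮ a₂}` lies
in `PD`; so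

  `P(T′) · D₀ ≤ D`  (**`Tp_mul_D0_le_D`**)  and  `P(Qᶜ, a₁ ↮ a₃) · P(Q) ≤ D`  (**`Qc_mul_Q_le_D`**).

Hence at `D = 0 < D₀` with `P(Q) > 0` the world `T′` is null, `{a₁ ↮ a₃} = Q` and `T = R = Q` up to
null sets, and `Tcl` collapses to

  `Q · [Q·P(Q, oL, bL) − P(Q, oL)·P(Q, bL)] + Q · [P(Q, oL)·P(Q, bH) − Q·P(Q, oL, bH)] ≥ 0`

by BHK06 Thm 1.2 (`bhk_same_cluster_events`: `o ∈ C₁`, `b ∈ C₁` positively associated under `Q`) and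
BHK06 Thm 1.4 (`bhk_cross_cluster`: `o ∈ C₁`, `b ∈ C₂` negatively correlated under `Q`); `P(Q) = 0`
or `D₀ = 0` give `Tcl = 0` outright.  **`Tcl_nonneg_of_D_eq_zero`**: `0 ≤ Tcl` at every instance with
`D = 0`.
-/

namespace Summit.Ventures.PercRepro2

open UnionCluster

namespace CovForm

namespace FirstOrder

section Meet

variable {V : Type*} {E : Type*} [Fintype E] [DecidableEq E] [Fintype V] [DecidableEq V]
  {R : Type*} [Field R] [LinearOrder R] [IsStrictOrderedRing R]

omit [Fintype E] [DecidableEq E] [Fintype V] [DecidableEq V] in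
/-- Membership in `PD`: `a₁ ↮ a₂`, `a₃ ↮ a₁`, `a₃ ↮ a₂`. -/
lemma mem_PDEvent_iff {ends : E → Sym2 V} {a₁ a₂ a₃ : V} {ω : Config E} :
    ω ∈ PDEvent ends a₁ a₂ a₃ ↔
      ¬ Conn ends ω a₁ a₂ ∧ ¬ Conn ends ω a₃ a₁ ∧ ¬ Conn ends ω a₃ a₂ := by
  simp only [PDEvent, Dtilde, inU, Set.mem_inter_iff, Set.mem_compl_iff, Set.mem_union,
    mem_connEvent, not_or]

omit [Fintype E] [DecidableEq E] [Fintype V] [DecidableEq V] in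
/-- Membership in `T′ = TEvent a₂ a₁ a₃`: `a₁ ↮ a₂`, `a₁ ↔ a₃`. -/
lemma mem_Tp_iff {ends : E → Sym2 V} {a₁ a₂ a₃ : V} {ω : Config E} :
    ω ∈ TEvent ends a₂ a₁ a₃ ↔ ¬ Conn ends ω a₁ a₂ ∧ Conn ends ω a₁ a₃ := by
  simp only [TEvent, Set.mem_inter_iff, Set.mem_compl_iff, mem_connEvent]

omit [Fintype E] [DecidableEq E] [Fintype V] [DecidableEq V] in
/-- Membership in `Q = {a₂ ↮ a₁}`. -/
lemma mem_Q_iff {ends : E → Sym2 V} {a₁ a₂ : V} {ω : Config E} :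
    ω ∈ avoidAll ends a₂ {a₁} ↔ ¬ Conn ends ω a₂ a₁ := by
  simp only [avoidAll, Set.mem_setOf_eq, Finset.mem_singleton, forall_eq]

omit [Fintype E] [DecidableEq E] [Fintype V] [DecidableEq V] in
/-- Membership in `{a₁ ↮ a₃}`. -/
lemma mem_D0_iff {ends : E → Sym2 V} {a₁ a₃ : V} {ω : Config E} :
    ω ∈ avoidAll ends a₁ {a₃} ↔ ¬ Conn ends ω a₁ a₃ := by
  simp only [avoidAll, Set.mem_setOf_eq, Finset.mem_singleton, forall_eq]

omit [Fintype V] [DecidableEq V] in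
/-- **Meet inequality 1**: `P(T′) · D₀ ≤ D` — a configuration of `T′ = {a₁ ↮ a₂, a₃ ∈ C₁}` met with a
configuration of `{a₁ ↮ a₃}` lies in `PD`. -/
theorem Tp_mul_D0_le_D (p : E → R) (hp : IsProbVec p) (ends : E → Sym2 V) (a₁ a₂ a₃ : V) :
    prob p (TEvent ends a₂ a₁ a₃) * D0 p ends a₁ a₃ ≤ prob p (PDEvent ends a₁ a₂ a₃) := by
  unfold D0
  have h := prob_mul_prob_le_of_sup_inf hp (A := TEvent ends a₂ a₁ a₃) (B := avoidAll ends a₁ {a₃})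
    (C := Set.univ) (D := PDEvent ends a₁ a₂ a₃) (fun ω hω ω' hω' => ?_)
  · simpa using h
  · refine ⟨Set.mem_univ _, ?_⟩
    rw [mem_Tp_iff] at hω
    rw [mem_D0_iff] at hω'
    rw [mem_PDEvent_iff]
    refine ⟨fun hc => hω.1 (conn_mono inf_le_left hc), fun hc => hω' (conn_symm (conn_mono inf_le_right hc)),
      fun hc => hω.1 (conn_trans hω.2 (conn_mono inf_le_left hc))⟩

omit [Fintype V] [DecidableEq V] in
/-- **Meet inequality 2**: `P(a₁ ↔ a₂, a₁ ↮ a₃) · P(Q) ≤ D` — a configuration of `{a₁ ↔ a₂, a₁ ↮ a₃}`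
met with a configuration of `Q = {a₁ ↮ a₂}` lies in `PD`. -/
theorem Qc_mul_Q_le_D (p : E → R) (hp : IsProbVec p) (ends : E → Sym2 V) (a₁ a₂ a₃ : V) :
    prob p ((avoidAll ends a₂ {a₁})ᶜ ∩ avoidAll ends a₁ {a₃}) * prob p (avoidAll ends a₂ {a₁}) ≤
      prob p (PDEvent ends a₁ a₂ a₃) := by
  have h := prob_mul_prob_le_of_sup_inf hp (A := (avoidAll ends a₂ {a₁})ᶜ ∩ avoidAll ends a₁ {a₃})
    (B := avoidAll ends a₂ {a₁}) (C := Set.univ) (D := PDEvent ends a₁ a₂ a₃) (fun ω hω ω' hω' => ?_)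
  · simpa using h
  · refine ⟨Set.mem_univ _, ?_⟩
    obtain ⟨hω1, hω2⟩ := hω
    rw [Set.mem_compl_iff, mem_Q_iff, not_not] at hω1
    rw [mem_D0_iff] at hω2
    rw [mem_Q_iff] at hω'
    rw [mem_PDEvent_iff]
    refine ⟨fun hc => hω' (conn_symm (conn_mono inf_le_right hc)),
      fun hc => hω2 (conn_symm (conn_mono inf_le_left hc)),
      fun hc => hω2 (conn_symm (conn_trans (conn_mono inf_le_left hc) hω1))⟩

end Meet

section Degenerate

variable {V : Type*} {E : Type*} [Fintype E] [DecidableEq E] [Fintype V] [DecidableEq V]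
  {R : Type*} [Field R] [LinearOrder R] [IsStrictOrderedRing R]

omit [Fintype E] [DecidableEq E] [Fintype V] [DecidableEq V] in
/-- `Q = {a₂ ↮ a₁} = {a₁ ↔ a₂}ᶜ`. -/
lemma Q_eq_compl (ends : E → Sym2 V) (a₁ a₂ : V) :
    avoidAll ends a₂ {a₁} = (connEvent ends a₁ a₂)ᶜ := by
  ext ω
  rw [mem_Q_iff, Set.mem_compl_iff, mem_connEvent]
  exact ⟨fun h hc => h (conn_symm hc), fun h hc => h (conn_symm hc)⟩

omit [Fintype E] [DecidableEq E] [Fintype V] [DecidableEq V] in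
/-- `{a₁ ↮ a₃} = {a₁ ↔ a₃}ᶜ`. -/
lemma D0_event_eq_compl (ends : E → Sym2 V) (a₁ a₃ : V) :
    avoidAll ends a₁ {a₃} = (connEvent ends a₁ a₃)ᶜ := by
  ext ω
  rw [mem_D0_iff, Set.mem_compl_iff, mem_connEvent]

omit [Fintype E] [DecidableEq E] [Fintype V] [DecidableEq V] in
/-- `T ⊆ Q`. -/
lemma T_subset_Q (ends : E → Sym2 V) (a₁ a₂ a₃ : V) :
    TEvent ends a₁ a₂ a₃ ⊆ avoidAll ends a₂ {a₁} := fun _ hω => (mem_Q_iff).2 hω.1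

omit [Fintype E] [DecidableEq E] [Fintype V] [DecidableEq V] in
/-- `T′ ⊆ Q`. -/
lemma Tp_subset_Q (ends : E → Sym2 V) (a₁ a₂ a₃ : V) :
    TEvent ends a₂ a₁ a₃ ⊆ avoidAll ends a₂ {a₁} :=
  fun _ hω => (mem_Q_iff).2 fun hc => hω.1 (conn_symm hc)

omit [Fintype E] [DecidableEq E] [Fintype V] [DecidableEq V] in
/-- The event of `Afo` (at `z = a₂`) lies in `T′`. -/
lemma Afo_event_subset_Tp (ends : E → Sym2 V) (o a₁ a₂ a₃ b : V) :
    avoidAll ends a₁ {a₂} ∩ connEvent ends a₁ a₃ ∩ connEvent ends a₂ b ∩ connEvent ends a₂ o ⊆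
      TEvent ends a₂ a₁ a₃ :=
  fun _ hω => (mem_Tp_iff).2 ⟨(mem_D0_iff).1 hω.1.1.1, hω.1.1.2⟩

/-- **`0 ≤ Tcl` at every instance with `D = 0`** (the degenerate corner of the degree-one-root
contraction): `D₀ = 0` or `P(Q) = 0` give `Tcl = 0`; otherwise the two meet inequalities make `T′`
null and `{a₁ ↮ a₃} = Q` up to null sets, and `Tcl = Q·[Q·P(Q,oL,bL) − P(Q,oL)·P(Q,bL)]
+ Q·[P(Q,oL)·P(Q,bH) − Q·P(Q,oL,bH)] ≥ 0` by BHK06 Thm 1.2 and Thm 1.4 under `Q`. -/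
theorem Tcl_nonneg_of_D_eq_zero (p : E → R) (hp : IsProbVec p) (ends : E → Sym2 V)
    (o a₁ a₂ a₃ b : V) (hD : prob p (PDEvent ends a₁ a₂ a₃) = 0) :
    0 ≤ Tcl p ends o a₁ a₂ a₃ b := by
  classical
  -- every `PD`-mass vanishes
  have hPD0 : ∀ X : Set (Config E), prob p (PDEvent ends a₁ a₂ a₃ ∩ X) = 0 := fun X =>
    le_antisymm (hD ▸ prob_inter_le_left hp _ _) (prob_nonneg hp _)
  have hDo : Do p ends o a₁ a₂ a₃ = 0 := by
    unfold Do
    rw [hPD0, hPD0]; ring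
  have hCc : FourTerm.Cc p ends o a₁ a₂ a₃ b = 0 := by
    unfold FourTerm.Cc
    rw [hD, hDo]; ring
  have hDmix : Dmix p ends o a₁ a₂ a₃ b = 0 := by
    unfold Dmix
    rw [hD, hDo]; ring
  have hq0 : 0 ≤ prob p (avoidAll ends a₂ {a₁}) := prob_nonneg hp _
  have hD00 : 0 ≤ D0 p ends a₁ a₃ := prob_nonneg hp _
  rcases eq_or_lt_of_le hD00 with h0 | h0
  · -- `D₀ = 0`: every term of `Tcl` vanishes
    have hDo0 : Do0 p ends o a₁ a₃ = 0 := by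
      unfold Do0
      unfold D0 at h0
      exact le_antisymm (h0 ▸ prob_inter_le_left hp _ _) (prob_nonneg hp _)
    unfold Tcl Cfo
    rw [hD, hCc, hDmix, hDo0, ← h0]
    ring_nf
    exact le_rfl
  rcases eq_or_lt_of_le hq0 with hq | hq
  · -- `P(Q) = 0`: every `Q`-mass vanishes
    have hQ0 : ∀ X : Set (Config E), prob p (avoidAll ends a₂ {a₁} ∩ X) = 0 := fun X =>
      le_antisymm (hq ▸ prob_inter_le_left hp _ _) (prob_nonneg hp _)
    have hSb : Sb p ends a₁ a₂ b = 0 := by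
      unfold Sb
      rw [hQ0, hQ0]; ring
    have hT : ∀ X : Set (Config E), prob p (TEvent ends a₁ a₂ a₃ ∩ X) = 0 := fun X =>
      le_antisymm ((prob_mono hp (Set.inter_subset_inter_left X (T_subset_Q ends a₁ a₂ a₃))).trans
        (hQ0 X).le) (prob_nonneg hp _)
    have hT' : prob p (TEvent ends a₁ a₂ a₃) = 0 := by
      have := hT Set.univ
      rwa [Set.inter_univ] at this
    unfold Tcl
    rw [hD, hCc, hDmix, hSb, ← hq, hT, hT, hT, hT']
    ring_nf
    exact le_rfl
  -- the main case `D₀ > 0`, `P(Q) > 0`: `T′` is null and `{a₁ ↮ a₃} = Q` up to null sets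
  have hTp : prob p (TEvent ends a₂ a₁ a₃) = 0 := by
    have h := Tp_mul_D0_le_D p hp ends a₁ a₂ a₃
    rw [hD] at h
    have h' : 0 ≤ prob p (TEvent ends a₂ a₁ a₃) := prob_nonneg hp _
    nlinarith
  have hTp0 : ∀ X : Set (Config E), prob p (TEvent ends a₂ a₁ a₃ ∩ X) = 0 := fun X =>
    le_antisymm (hTp ▸ prob_inter_le_left hp _ _) (prob_nonneg hp _)
  have hQc : prob p ((avoidAll ends a₂ {a₁})ᶜ ∩ avoidAll ends a₁ {a₃}) = 0 := by
    have h := Qc_mul_Q_le_D p hp ends a₁ a₂ a₃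
    rw [hD] at h
    have h' : 0 ≤ prob p ((avoidAll ends a₂ {a₁})ᶜ ∩ avoidAll ends a₁ {a₃}) := prob_nonneg hp _
    nlinarith
  have hQc0 : ∀ X : Set (Config E), prob p ((avoidAll ends a₂ {a₁})ᶜ ∩ avoidAll ends a₁ {a₃} ∩ X) = 0 :=
    fun X => le_antisymm (hQc ▸ prob_inter_le_left hp _ _) (prob_nonneg hp _)
  -- the `T`-masses and `R`-masses are `Q`-masses
  have hT : ∀ X : Set (Config E), prob p (TEvent ends a₁ a₂ a₃ ∩ X) = prob p (avoidAll ends a₂ {a₁} ∩ X) := by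
    intro X
    have h := Qsplit p ends a₁ a₂ a₃ X
    rw [hPD0, hTp0] at h
    linarith
  have hR : ∀ X : Set (Config E), prob p (avoidAll ends a₁ {a₂, a₃} ∩ X) = prob p (avoidAll ends a₂ {a₁} ∩ X) := by
    intro X
    have h := ZOloc.prob_R_add_Tp p ends a₁ a₂ a₃ X
    rw [hTp0] at h
    linarith
  -- the `D₀`-masses are `Q`-masses
  have hA : ∀ X : Set (Config E), prob p (avoidAll ends a₁ {a₃} ∩ X) = prob p (avoidAll ends a₂ {a₁} ∩ X) := by
    intro X
    have h := prob_inter_add_prob_inter_compl p (avoidAll ends a₁ {a₃} ∩ X) (avoidAll ends a₂ {a₁})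
    have e1 : avoidAll ends a₁ {a₃} ∩ X ∩ avoidAll ends a₂ {a₁} = avoidAll ends a₁ {a₂, a₃} ∩ X := by
      rw [ZOloc.R_eq_Q_inter, D0_event_eq_compl]
      ext ω; simp only [Set.mem_inter_iff]; tauto
    have e2 : avoidAll ends a₁ {a₃} ∩ X ∩ (avoidAll ends a₂ {a₁})ᶜ =
        (avoidAll ends a₂ {a₁})ᶜ ∩ avoidAll ends a₁ {a₃} ∩ X := by
      ext ω; simp only [Set.mem_inter_iff]; tauto
    rw [e1, e2, hR, hQc0] at h
    linarith
  have hD0 : D0 p ends a₁ a₃ = prob p (avoidAll ends a₂ {a₁}) := by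
    unfold D0
    have := hA Set.univ
    rwa [Set.inter_univ, Set.inter_univ] at this
  have hDo0 : Do0 p ends o a₁ a₃ = prob p (avoidAll ends a₂ {a₁} ∩ connEvent ends a₁ o) := hA _
  have hAfo : Afo p ends o a₁ a₃ b a₂ = 0 := by
    unfold Afo
    exact le_antisymm ((prob_mono hp (Afo_event_subset_Tp ends o a₁ a₂ a₃ b)).trans hTp.le)
      (prob_nonneg hp _)
  have hCfo : Cfo p ends o a₁ a₃ b a₂ =
      prob p (avoidAll ends a₂ {a₁} ∩ connEvent ends a₁ o) * prob p (avoidAll ends a₂ {a₁} ∩ connEvent ends a₂ b) -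
        prob p (avoidAll ends a₂ {a₁}) * prob p (avoidAll ends a₂ {a₁} ∩ (connEvent ends a₁ o ∩ connEvent ends a₂ b)) := by
    unfold Cfo
    have e : avoidAll ends a₁ {a₂, a₃} ∩ connEvent ends a₂ b ∩ connEvent ends a₁ o =
        avoidAll ends a₁ {a₂, a₃} ∩ (connEvent ends a₁ o ∩ connEvent ends a₂ b) := by
      ext ω; simp only [Set.mem_inter_iff]; tauto
    rw [e, hR, hR, hD0, hDo0]
  have hSb : Sb p ends a₁ a₂ b =
      prob p (avoidAll ends a₂ {a₁} ∩ connEvent ends a₁ b) - prob p (avoidAll ends a₂ {a₁} ∩ connEvent ends a₂ b) := rfl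
  -- BHK06 Thm 1.2 and Thm 1.4 under `Q`
  have hsame : prob p (avoidAll ends a₂ {a₁} ∩ connEvent ends a₁ o) * prob p (avoidAll ends a₂ {a₁} ∩ connEvent ends a₁ b) ≤
      prob p (avoidAll ends a₂ {a₁} ∩ (connEvent ends a₁ o ∩ connEvent ends a₁ b)) * prob p (avoidAll ends a₂ {a₁}) := by
    have h := bhk_same_cluster_events p hp ends a₁ a₂ (isUpperSet_mem_setOf o) (isUpperSet_mem_setOf b)
    rw [← connEvent_eq_clusterInEvent ends a₁ o, ← connEvent_eq_clusterInEvent ends a₁ b, ← Q_eq_compl] at h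
    have e1 : connEvent ends a₁ o ∩ avoidAll ends a₂ {a₁} = avoidAll ends a₂ {a₁} ∩ connEvent ends a₁ o :=
      Set.inter_comm _ _
    have e2 : connEvent ends a₁ b ∩ avoidAll ends a₂ {a₁} = avoidAll ends a₂ {a₁} ∩ connEvent ends a₁ b :=
      Set.inter_comm _ _
    have e3 : connEvent ends a₁ o ∩ connEvent ends a₁ b ∩ avoidAll ends a₂ {a₁} =
        avoidAll ends a₂ {a₁} ∩ (connEvent ends a₁ o ∩ connEvent ends a₁ b) := Set.inter_comm _ _
    rw [e1, e2, e3] at h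
    exact h
  have hcross : prob p (avoidAll ends a₂ {a₁} ∩ (connEvent ends a₁ o ∩ connEvent ends a₂ b)) * prob p (avoidAll ends a₂ {a₁}) ≤
      prob p (avoidAll ends a₂ {a₁} ∩ connEvent ends a₁ o) * prob p (avoidAll ends a₂ {a₁} ∩ connEvent ends a₂ b) := by
    have h := bhk_cross_cluster p hp ends a₁ a₂ (isUpperSet_mem_setOf o) (isUpperSet_mem_setOf b)
    rw [← connEvent_eq_clusterInEvent ends a₁ o, ← connEvent_eq_clusterInEvent ends a₂ b, ← Q_eq_compl] at h
    have e1 : connEvent ends a₁ o ∩ avoidAll ends a₂ {a₁} = avoidAll ends a₂ {a₁} ∩ connEvent ends a₁ o :=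
      Set.inter_comm _ _
    have e2 : connEvent ends a₂ b ∩ avoidAll ends a₂ {a₁} = avoidAll ends a₂ {a₁} ∩ connEvent ends a₂ b :=
      Set.inter_comm _ _
    have e3 : connEvent ends a₁ o ∩ connEvent ends a₂ b ∩ avoidAll ends a₂ {a₁} =
        avoidAll ends a₂ {a₁} ∩ (connEvent ends a₁ o ∩ connEvent ends a₂ b) := Set.inter_comm _ _
    rw [e1, e2, e3] at h
    exact h
  -- assemble
  have hT1 := hT (connEvent ends a₁ o ∩ connEvent ends a₁ b)
  have hT2 := hT (connEvent ends a₁ o)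
  have hT3 := hT (connEvent ends a₁ b)
  have hT4 : prob p (TEvent ends a₁ a₂ a₃) = prob p (avoidAll ends a₂ {a₁}) := by
    have := hT Set.univ
    rwa [Set.inter_univ, Set.inter_univ] at this
  unfold Tcl
  rw [hD, hCc, hDmix, hAfo, hCfo, hSb, hD0, hDo0, hPD0, hPD0, hTp0, hTp0, hT1, hT2, hT3, hT4]
  have k1 := mul_nonneg hq0 (sub_nonneg.2 hsame)
  have k2 := mul_nonneg hq0 (sub_nonneg.2 hcross)
  linarith

end Degenerate

end FirstOrder

end CovForm

end Summit.Ventures.PercRepro2
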